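import Summits.NavierStokesRegularity.NavierStokesRegularity.Theorems.LerayQuarterDissipationRecurrentDissipativeLiouvilleCriticalRecurrent
import Summits.NavierStokesRegularity.NavierStokesRegularity.Theorems.LerayQuarterDissipationFiniteDissipationLiouvilleLinks
import HarnessLib

/-!
# Crux `FiniteDissipationLiouville` (stmt-22144) ⟺ "no recurrent critical near-saturating
# singular member of the stratum" — the critical-element REDUCTION of the crux, by name

Theorems file of route `LerayQuarterDissipation` (seat ns-lqd-p1 g2; `--supports` the crux).
Navier–Stokes regularity is NOT proved by anything here; no summit is.

`finiteDissipationLiouville_iff_noCriticalElement`: the crux `FiniteDissipationLiouville` (and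
hence its equivalent child `RecurrentDissipativeLiouville`, `…Links`) holds iff NO member `w` of the
stratum is simultaneously (1) singular at the apex, (2) uniformly recurrent under the scaling flow,
(3) critical — no member with the same Type-I constant and a smaller dissipation constant is
singular — and (4) near-saturating — for every `ε > 0` its dimensionless dissipation exceeds
`K − ε` somewhere in every sufficiently long backward log-window. (`→` is trivial; `←` is the
recurrent critical element `…CriticalElement.exists_recurrent_criticalElement`, p592568.) So a
proof of the crux may ASSUME (2)–(4) of a putative singular member; this is the statement a planner
may register as the reshaped obligation of the line.
-/

noncomputable section

-- the summit and its single sub-problem share the name (CONVENTIONS §1), as in every Theorems file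
set_option linter.dupNamespace false

namespace Summit.NavierStokesRegularity.NavierStokesRegularity.Theorems.FiniteDissipationLiouville.CriticalElement

open MeasureTheory Set Filter Topology Metric Function
open Literature.Analysis Literature.Analysis.FluidPDE
open scoped ENNReal NNReal

/-- **The critical-element reduction of the crux.** `FiniteDissipationLiouville` holds iff every
member `w` of the stratum (any `C`, `K`) which is uniformly recurrent under the scaling flow,
critical (no member of `𝒟_{C,K'}`, `K' < K`, is singular at the apex) and near-saturating
(`∀ ε > 0 ∃ Λ > 1 ∀ τ < 0 ∃ t ∈ [Λ²τ, τ/Λ²], (K−ε)/√(−t) < ∫‖∇w(t)‖²`) is bounded on some backward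
cylinder at the origin. -/
theorem finiteDissipationLiouville_iff_noCriticalElement :
    Theses.LerayQuarterDissipation.FiniteDissipationLiouville ↔
      ∀ (C K : ℝ) (w : ℝ → EuclideanSpace ℝ (Fin 3) → EuclideanSpace ℝ (Fin 3)),
        IsTypeIAncientMild C w →
        (∀ s : ℝ, s < 0 → ∫⁻ x, ‖fderiv ℝ (w s) x‖ₑ ^ 2 ≤ ENNReal.ofReal (K / Real.sqrt (-s))) →
        (∀ ε > 0, ∀ R > 1, ∃ L > 0, ∀ a : ℝ, ∃ σ ∈ Set.Icc a (a + L),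
          ∀ s ∈ Set.Icc (-(R ^ 2)) (-(R⁻¹) ^ 2),
          ∀ y ∈ Metric.closedBall (0 : EuclideanSpace ℝ (Fin 3)) R,
            ‖Real.exp σ • w (Real.exp (2 * σ) * s) (Real.exp σ • y) - w s y‖ ≤ ε) →
        (∀ K' : ℝ, K' < K → ∀ v : ℝ → EuclideanSpace ℝ (Fin 3) → EuclideanSpace ℝ (Fin 3),
          IsTypeIAncientMild C v →
          (∀ s : ℝ, s < 0 → ∫⁻ x, ‖fderiv ℝ (v s) x‖ₑ ^ 2 ≤ ENNReal.ofReal (K' / Real.sqrt (-s))) →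
          ¬ (∀ r > 0, ∀ M : ℝ, ∃ t ∈ Set.Ioo (-(r ^ 2)) (0 : ℝ),
            ∃ x ∈ Metric.ball (0 : EuclideanSpace ℝ (Fin 3)) r, M < ‖v t x‖)) →
        (∀ ε : ℝ, 0 < ε → ∃ Λ : ℝ, 1 < Λ ∧ ∀ τ : ℝ, τ < 0 →
          ∃ t ∈ Set.Icc (Λ ^ 2 * τ) (τ / Λ ^ 2),
            ENNReal.ofReal ((K - ε) / Real.sqrt (-t)) < ∫⁻ x, ‖fderiv ℝ (w t) x‖ₑ ^ 2) →
        ¬ (∀ r > 0, ∀ M : ℝ, ∃ t ∈ Set.Ioo (-(r ^ 2)) (0 : ℝ),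
            ∃ x ∈ Metric.ball (0 : EuclideanSpace ℝ (Fin 3)) r, M < ‖w t x‖) := by
  constructor
  · intro hF C K w hw hlaw _ _ _
    exact hF C K w hw hlaw
  · intro h C K u hu hlaw hsing
    obtain ⟨K₀, -, hce⟩ := exists_recurrent_criticalElement
    obtain ⟨Kc, w, -, -, hw, hlaww, hsingw, hrec, hmin, hsat⟩ := hce C K u hu hlaw hsing
    exact h C Kc w hw hlaww hrec hmin hsat hsingw

/-- The same reduction for the child crux `RecurrentDissipativeLiouville` (stmt-22508), through
`FiniteDissipationLiouville ↔ RecurrentDissipativeLiouville` (`…Links`). -/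
theorem recurrentDissipativeLiouville_iff_noCriticalElement :
    Theses.LerayQuarterDissipation.RecurrentDissipativeLiouville ↔
      ∀ (C K : ℝ) (w : ℝ → EuclideanSpace ℝ (Fin 3) → EuclideanSpace ℝ (Fin 3)),
        IsTypeIAncientMild C w →
        (∀ s : ℝ, s < 0 → ∫⁻ x, ‖fderiv ℝ (w s) x‖ₑ ^ 2 ≤ ENNReal.ofReal (K / Real.sqrt (-s))) →
        (∀ ε > 0, ∀ R > 1, ∃ L > 0, ∀ a : ℝ, ∃ σ ∈ Set.Icc a (a + L),
          ∀ s ∈ Set.Icc (-(R ^ 2)) (-(R⁻¹) ^ 2),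
          ∀ y ∈ Metric.closedBall (0 : EuclideanSpace ℝ (Fin 3)) R,
            ‖Real.exp σ • w (Real.exp (2 * σ) * s) (Real.exp σ • y) - w s y‖ ≤ ε) →
        (∀ K' : ℝ, K' < K → ∀ v : ℝ → EuclideanSpace ℝ (Fin 3) → EuclideanSpace ℝ (Fin 3),
          IsTypeIAncientMild C v →
          (∀ s : ℝ, s < 0 → ∫⁻ x, ‖fderiv ℝ (v s) x‖ₑ ^ 2 ≤ ENNReal.ofReal (K' / Real.sqrt (-s))) →
          ¬ (∀ r > 0, ∀ M : ℝ, ∃ t ∈ Set.Ioo (-(r ^ 2)) (0 : ℝ),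
            ∃ x ∈ Metric.ball (0 : EuclideanSpace ℝ (Fin 3)) r, M < ‖v t x‖)) →
        (∀ ε : ℝ, 0 < ε → ∃ Λ : ℝ, 1 < Λ ∧ ∀ τ : ℝ, τ < 0 →
          ∃ t ∈ Set.Icc (Λ ^ 2 * τ) (τ / Λ ^ 2),
            ENNReal.ofReal ((K - ε) / Real.sqrt (-t)) < ∫⁻ x, ‖fderiv ℝ (w t) x‖ₑ ^ 2) →
        ¬ (∀ r > 0, ∀ M : ℝ, ∃ t ∈ Set.Ioo (-(r ^ 2)) (0 : ℝ),
            ∃ x ∈ Metric.ball (0 : EuclideanSpace ℝ (Fin 3)) r, M < ‖w t x‖) :=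
  Links.finiteDissipationLiouville_iff_recurrentDissipativeLiouville.symm.trans
    finiteDissipationLiouville_iff_noCriticalElement

end Summit.NavierStokesRegularity.NavierStokesRegularity.Theorems.FiniteDissipationLiouville.CriticalElement

end
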